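import Literature.NumberTheory.Automorphic.QuadraticCharacterTwist
import Literature.NumberTheory.QuadraticForms.HilbertReciprocityInputs
import Literature.NumberTheory.QuadraticForms.HilbertReciprocityReduction
import Literature.NumberTheory.QuadraticForms.HasseNormTheoremHolds
import Literature.NumberTheory.QuadraticForms.QuadraticExtensionPlaces
import Literature.NumberTheory.QuadraticForms.HilbertSymbolUnramified
import Literature.NumberTheory.QuadraticForms.GlobalSquareTheorem
import Literature.NumberTheory.GaloisRepresentations.HeckeCharacterOfRayClass
import HarnessLib

/-!
# The quadratic Hecke character `ω_{E/F}` from the norm index theorem, and the quadratic twist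
# `exists_twist_quadraticSign` from O'Meara 71:17 / Hilbert reciprocity

Topic `NumberTheory/Automorphic`; namespace `Literature.NumberTheory.Automorphic`. Everything in
this file is PROVED (no `sorry`, one definition with a body, no new named fact).

The named fact `exists_twist_quadraticSign` (`TunnellOctahedralGlobal`; Arthur–Clozel 1989, Ch. 3,
proof of Thm. 3.1, p. 172: for the character `η` of `𝔸_F^×` "vanishing exactly on
`F^* N(𝔸_E^*)`", "`ζ_v = η(ϖ_v)` … is a root of unity of order `f_v`") was reduced in
`LanglandsTunnellTwist` / `QuadraticCharacterTwist` to the existence, for every quadratic extension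
`E/F` of number fields, of a Hecke character `ω` of `F` of finite order with `ω(ϖ_v) = ε_{E/F}(v)`
at almost every `v` — there obtained from Artin reciprocity (`artinReciprocity_character`, global
class field theory, a named fact). This file **constructs `ω` directly**, exactly as Arthur–Clozel
describe it, from the class field theory of quadratic extensions PROVED in
`Literature/NumberTheory/QuadraticForms` (O'Meara, *Introduction to quadratic forms*, §65):

* write `E = F(√θ)` with `θ ∈ 𝓞 F` a non-square (`exists_integer_sq_eq_of_finrank_eq_two`);
* `G = P_F · N_{E/F} J_F = principalIdeles F ⊔ normIdeles F θ` has index `2` in the idèle group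
  `𝕀_F` — **the norm index theorem, O'Meara 65:21, a theorem of the tree**
  (`OMeara65.normIdeles_index_eq_two_holds`, `HasseNormTheoremHolds.lean`);
* `G` is open: the norm idèles contain a neighbourhood of `1` (`normIdeles_mem_nhds_one`: local
  squares near `1` at the places dividing `2θ`, O'Meara 63:1b; units are norms at the other finite
  places, O'Meara 63:12; positive reals and all of `ℂ` at infinity);
* `ω = quadraticHeckeChar θ …` is the sign character of `G` (`signCharOfIndexTwo`): continuous,
  trivial on `F^×`, of order `2`, unramified at every `v ∤ 2θ`, and `ω(ϖ_v) = 1` at the `v ∤ 2θ`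
  where `θ ∈ F_v²`, i.e. where `v` splits in `E` (O'Meara §65A,
  `QuadraticExtension.ncard_finitePlacesOver_eq_two_iff_isSquare`);
* at an inert `v ∤ 2θ` (`θ ∉ F_v²`, `f_v = 2`), `ω(ϖ_v) = -1` **iff `I_F^v ⊄ P_F N_{E/F} J_E`**, which
  is O'Meara's Prop. 71:17 — the decomposition law at inert primes, the one input not yet proved in
  the tree: it is the named fact `QuadraticForms.range_localUnits_not_le_of_inertiaDegIn_eq_two`
  (`HilbertReciprocityInputs.lean`), equivalent (given the theorems of the tree) to Hilbert's
  reciprocity law 71:18 (`QuadraticForms.hilbertReciprocity`, `HilbertSymbol.lean`):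
  `hilbertReciprocity_of_facts` (`HilbertReciprocityProofs.lean`) for one direction and
  `range_localUnits_not_le_of_hilbertReciprocity` below for the other.

Main results:

* `exists_heckeCharacter_quadraticSign_of_inert` — for `E/F` quadratic, granting 71:17 for `F`:
  `∃ ω` of finite order with `ω` unramified and `ω(ϖ_v) = quadraticSign E v` for almost all `v`;
* `exists_twist_quadraticSign_of_range_localUnits_not_le` — **`exists_twist_quadraticSign` from
  O'Meara 71:17** (for all number fields), by `π' = π ⊗ (ω ∘ det)`
  (`CuspidalAutomorphicRepData.twist`, `AutomorphicRepData.eventually_hasSatakeParamAt_twist`);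
* `range_localUnits_not_le_of_hilbertReciprocity` — 71:18 ⇒ 71:17 (an idèle `⟨u⟩_v` with `u` a
  local non-norm at the inert `v`, if in `P_F N_{E/F} J_E`, reads off `γ ∈ F^×` with `(γ, θ)_𝔭 = -1`
  exactly at `𝔭 = v`: an odd number of places, `exists_placeSymbol_eq_neg_one_iff_of_mem_sup`);
* `exists_twist_quadraticSign_of_hilbertReciprocity` — **`exists_twist_quadraticSign` from
  Hilbert's reciprocity law** (for all number fields).

So the leaf below `exists_twist_quadraticSign` is now O'Meara 71:17 ≡ 71:18 (whose remaining
input in the tree is the ten-field construction 71:16, `CyclotomicCrossing.lean`,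
`NormIdelesEqTopOfPairs.lean`), instead of Artin reciprocity for all characters.

## References

* J. Arthur, L. Clozel, *Simple algebras, base change, and the advanced theory of the trace
  formula*, Ann. of Math. Stud. 120 (1989), Ch. 3, proof of Thm. 3.1 (p. 172), Thm. 4.2 (d).
  [ArthurClozelAMS120]
* O. T. O'Meara, *Introduction to quadratic forms*, Grundlehren 117 (1963), §63A (63:1b), §63B
  (63:12), §65A (Example 65:2), §65D (65:21), §71C (71:17), §71D (71:18). [Omeara1963]
* J. Tate, *Global class field theory*, in Cassels–Fröhlich (1967), Ch. VII §4.1 (open subgroups of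
  `J_K` and characters of finite order). [CasselsFrohlichANT1967]
-/

noncomputable section

open scoped NumberField
open NumberField IsDedekindDomain Filter Topology

namespace Literature.NumberTheory.Automorphic

open QuadraticForms GaloisRepresentations

/-! ### Quadratic extensions are `F(√θ)` with `θ` an algebraic integer -/

section NormalForm

variable {F E : Type*} [Field F] [NumberField F] [Field E] [Algebra F E]

/-- **A quadratic extension of a number field is `F(√θ)` with `θ ∈ 𝓞 F`**: if `[E : F] = 2` there
are a non-zero algebraic integer `θ` of `F` and `α ∈ E ∖ F` with `α² = θ` (take `α₀ = x - σ x` for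
the non-trivial automorphism `σ` and any `x` it moves: `σ α₀ = -α₀`, so `α₀² ∈ F`; then clear
denominators by a square). [folklore] -/
theorem exists_integer_sq_eq_of_finrank_eq_two (h2 : Module.finrank F E = 2) :
    ∃ (θ : 𝓞 F) (α : E), θ ≠ 0 ∧ α ^ 2 = algebraMap F E (θ : F) ∧
      ∀ r : F, algebraMap F E r ≠ α := by
  haveI : FiniteDimensional F E := Module.finite_of_finrank_eq_succ h2
  haveI : Algebra.IsQuadraticExtension F E := ⟨h2⟩
  haveI : CharZero E := charZero_of_injective_algebraMap (algebraMap F E).injective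
  obtain ⟨σ, hσ⟩ := QuadraticExtension.exists_algEquiv_ne_one (K := F) (E := E)
  -- an element moved by `σ`
  obtain ⟨x, hx⟩ : ∃ x : E, σ x ≠ x := by
    by_contra! h
    exact hσ (AlgEquiv.ext h)
  set α₀ : E := x - σ x with hα₀
  have hσα₀ : σ α₀ = -α₀ := by
    rw [hα₀, map_sub, QuadraticExtension.algEquiv_algEquiv_apply hσ x]; ring
  have hα₀0 : α₀ ≠ 0 := fun h ↦ hx (sub_eq_zero.1 h).symm
  -- `α₀² ∈ F`
  have hfix : σ (α₀ ^ 2) = α₀ ^ 2 := by rw [map_pow, hσα₀, neg_sq]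
  obtain ⟨θ₀, hθ₀⟩ := QuadraticExtension.exists_algebraMap_eq_of_fixed hσ hfix
  have hαF : ∀ r : F, algebraMap F E r ≠ α₀ := by
    intro r hr
    have h1 : σ α₀ = α₀ := by rw [← hr, AlgEquiv.commutes]
    rw [hσα₀, neg_eq_iff_add_eq_zero, ← two_mul, mul_eq_zero] at h1
    rcases h1 with h1 | h1
    · exact two_ne_zero h1
    · exact hα₀0 h1
  have hθ₀0 : θ₀ ≠ 0 := QuadraticExtension.ne_zero_of_sq_eq hθ₀.symm hαF
  -- clear denominators: `θ₀ c² = θ ∈ 𝓞 F`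
  obtain ⟨θ, c, hθ, hc, hθc⟩ := exists_mul_sq_eq_algebraMap F hθ₀0
  refine ⟨θ, α₀ * algebraMap F E c, hθ, ?_, fun r hr ↦ ?_⟩
  · rw [mul_pow, ← hθ₀, ← map_pow, ← map_mul, hθc]
  · refine hαF (r / c) ?_
    rw [map_div₀, hr, mul_div_assoc, div_self ((map_ne_zero _).2 hc), mul_one]

end NormalForm

/-! ### The norm idèles are open -/

section Open

variable (F : Type) [Field F] [NumberField F]

/-- **The norm idèles `N_{E/F} J_E = normIdeles F θ` of `E = F(√θ)`, `θ ∈ 𝓞 F ∖ {0}`, contain a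
neighbourhood of `1` in `𝕀_F`**: an idèle which is a local unit everywhere, congruent to `1` modulo
`4𝔭` at the finitely many `𝔭 ∣ 2θ`, and positive at the real places, is a local norm everywhere —
a local square at `𝔭 ∣ 2θ` (O'Meara 63:1b, `isSquare_of_valued_sub_one_lt`) and at the infinite
places, and a unit against the unit `θ` at the remaining non-dyadic places (O'Meara 63:12,
`hilbertSymbol_eq_one_of_valued_eq_one_of_notMem`). [cite: Omeara1963, §63 Example 63:12 and
Cor. 63:1b] -/
theorem normIdeles_mem_nhds_one (θ : 𝓞 F) (hθ : θ ≠ 0) :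
    (normIdeles F (θ : F) : Set (ideleGroup F)) ∈ 𝓝 (1 : ideleGroup F) := by
  classical
  haveI : ∀ v : HeightOneSpectrum (𝓞 F), CharZero (v.adicCompletion F) := fun v ↦
    charZero_of_injective_algebraMap (algebraMap F _).injective
  -- the finite exceptional set `S = {𝔭 ∣ 2θ}`
  set S : Set (HeightOneSpectrum (𝓞 F)) :=
    {v | θ ∈ v.asIdeal} ∪ {v | (2 : 𝓞 F) ∈ v.asIdeal} with hS
  have hSfin : S.Finite :=
    (finite_setOf_mem_asIdeal F hθ).union (finite_setOf_mem_asIdeal F two_ne_zero)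
  -- (A) local units everywhere
  have hA : (unitIdeles F : Set (ideleGroup F)) ∈ 𝓝 (1 : ideleGroup F) :=
    (isOpen_unitIdeles F).mem_nhds (unitIdeles F).one_mem
  -- (B) close to `1` at `S`
  have hB : (⋂ v ∈ S, {x : ideleGroup F |
      Valued.v ((x : AdeleRing (𝓞 F) F).2 v - 1) < Valued.v (4 : v.adicCompletion F)}) ∈
        𝓝 (1 : ideleGroup F) := by
    refine (Filter.biInter_mem hSfin).mpr fun v _ ↦ ?_
    have h4 : (4 : v.adicCompletion F) ≠ 0 := by norm_num
    have hne : Valued.v.restrict (4 : v.adicCompletion F) ≠ 0 := by simp [h4]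
    have h1 : {c : v.adicCompletion F | Valued.v (c - 1) < Valued.v (4 : v.adicCompletion F)} ∈
        𝓝 ((fun x : ideleGroup F ↦ (x : AdeleRing (𝓞 F) F).2 v) 1) := by
      change _ ∈ 𝓝 (1 : v.adicCompletion F)
      rw [Valued.mem_nhds]
      refine ⟨Units.mk0 _ hne, fun c hc ↦ ?_⟩
      rw [Set.mem_setOf_eq, Units.val_mk0] at hc
      exact Valued.v.restrict_lt_iff.mp hc
    exact (continuous_ideleGroup_snd_apply v).continuousAt.preimage_mem_nhds h1
  -- (C) positive at the real places
  have hC : (⋂ w : InfinitePlace F, {x : ideleGroup F | ∀ hw : w.IsReal,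
      0 < InfinitePlace.Completion.extensionEmbeddingOfIsReal hw ((x : AdeleRing (𝓞 F) F).1 w)}) ∈
        𝓝 (1 : ideleGroup F) := by
    refine (Filter.iInter_mem).mpr fun w ↦ ?_
    by_cases hw : w.IsReal
    · have hc : Continuous fun x : ideleGroup F ↦
          InfinitePlace.Completion.extensionEmbeddingOfIsReal hw ((x : AdeleRing (𝓞 F) F).1 w) :=
        (InfinitePlace.Completion.isometry_extensionEmbeddingOfIsReal hw).continuous.comp
          (continuous_ideleGroup_fst_apply w)
      have h1 : (fun x : ideleGroup F ↦
          InfinitePlace.Completion.extensionEmbeddingOfIsReal hw ((x : AdeleRing (𝓞 F) F).1 w)) ⁻¹'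
            Set.Ioi 0 ∈ 𝓝 (1 : ideleGroup F) := by
        refine hc.continuousAt.preimage_mem_nhds (isOpen_Ioi.mem_nhds ?_)
        change 0 < InfinitePlace.Completion.extensionEmbeddingOfIsReal hw
          (((1 : ideleGroup F) : AdeleRing (𝓞 F) F).1 w)
        have : (((1 : ideleGroup F) : AdeleRing (𝓞 F) F).1 w) = 1 := rfl
        rw [this, map_one]; exact one_pos
      exact Filter.mem_of_superset h1 fun x hx _ ↦ hx
    · exact Filter.univ_mem' fun x hw' ↦ absurd hw' hw
  refine Filter.mem_of_superset (Filter.inter_mem hA (Filter.inter_mem hB hC)) ?_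
  rintro x ⟨hxA, hxB, hxC⟩
  rw [SetLike.mem_coe, mem_normIdeles_iff]
  refine ⟨fun v ↦ ?_, fun w ↦ ?_⟩
  · by_cases hv : v ∈ S
    · -- a local square
      have hlt := Set.mem_iInter₂.mp hxB v hv
      exact mem_quadraticNormSubgroup_of_isSquare _ (isSquare_of_valued_sub_one_lt F v hlt)
    · -- a unit against a unit at a non-dyadic place
      simp only [hS, Set.mem_union, Set.mem_setOf_eq, not_or] at hv
      have hunit : Valued.v ((x : AdeleRing (𝓞 F) F).2 v) = 1 := mem_unitIdeles_iff.1 hxA v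
      have hθv : algebraMap F (v.adicCompletion F) (θ : F) ≠ 0 :=
        (map_ne_zero _).2 (by exact_mod_cast hθ)
      refine (hilbertSymbol_eq_one_iff_mem_quadraticNormSubgroup hθv (ideleFiniteComponent F v x)).1 ?_
      have key := hilbertSymbol_eq_one_of_valued_eq_one_of_notMem F v hv.2 hv.1 hunit
      rw [IsScalarTower.algebraMap_apply (𝓞 F) F (v.adicCompletion F)] at key
      exact key
  · by_cases hw : w.IsReal
    · refine mem_quadraticNormSubgroup_of_isSquare _ (isSquare_completion_of_pos hw ?_)
      rw [InfinitePlace.Completion.ringEquivRealOfIsReal_apply]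
      exact Set.mem_iInter.mp hxC w hw
    · rw [InfinitePlace.not_isReal_iff_isComplex] at hw
      exact mem_quadraticNormSubgroup_of_isSquare _ (isSquare_completion_of_isComplex hw _)

/-- Hence **`P_F · N_{E/F} J_E = principalIdeles F ⊔ normIdeles F θ` is an open subgroup of `𝕀_F`**
(a subgroup containing a neighbourhood of `1`). [folklore] -/
theorem isOpen_principalIdeles_sup_normIdeles (θ : 𝓞 F) (hθ : θ ≠ 0) :
    IsOpen ((principalIdeles F ⊔ normIdeles F (θ : F) : Subgroup (ideleGroup F)) :
      Set (ideleGroup F)) :=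
  Subgroup.isOpen_mono le_sup_right
    (Subgroup.isOpen_of_mem_nhds _ (normIdeles_mem_nhds_one F θ hθ))

end Open

/-! ### The quadratic Hecke character of `F(√θ)/F` -/

section Character

variable (F : Type) [Field F] [NumberField F]

omit [NumberField F] in
/-- A non-square is non-zero. [folklore] -/
theorem RingOfIntegers.ne_zero_of_not_isSquare {θ : 𝓞 F} (hθ : ¬ IsSquare (θ : F)) : θ ≠ 0 := by
  rintro rfl
  exact hθ ⟨0, by simp⟩

/-- **The norm index theorem** (O'Meara 65:21, proved in the tree as
`OMeara65.normIdeles_index_eq_two_holds`): `(𝕀_F : P_F · N_{E/F} J_E) = 2` for `E = F(√θ)`,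
`θ` a non-square. [cite: Omeara1963, §65D Prop. 65:21] -/
theorem index_principalIdeles_sup_normIdeles (θ : F) (hθ : ¬ IsSquare θ) :
    (principalIdeles F ⊔ normIdeles F θ).index = 2 :=
  OMeara65.normIdeles_index_eq_two_holds F θ hθ

/-- **The quadratic Hecke character `ω = ω_{E/F}` of `E = F(√θ)`** (`θ ∈ 𝓞 F` a non-square):
the character of `𝕀_F` "vanishing exactly on `F^* N(𝔸_E^*)`" (Arthur–Clozel, Ch. 3, p. 172), i.e.
the sign character of the index-two open subgroup `P_F · N_{E/F} J_E = principalIdeles F ⊔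
normIdeles F θ` (`index_principalIdeles_sup_normIdeles`, `isOpen_principalIdeles_sup_normIdeles`):
continuous (open kernel) and trivial on the principal idèles.
[cite: ArthurClozelAMS120, Ch. 3, proof of Thm. 3.1 (p. 172)] -/
def quadraticHeckeChar (θ : 𝓞 F) (hθ : ¬ IsSquare (θ : F)) : HeckeCharacter F where
  toContinuousMonoidHom :=
    { signCharOfIndexTwo (R := ℂ) (principalIdeles F ⊔ normIdeles F (θ : F))
        (index_principalIdeles_sup_normIdeles F (θ : F) hθ) with
      continuous_toFun := MonoidHom.continuous_of_isOpen_ker _ (by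
        rw [ker_signCharOfIndexTwo]
        exact isOpen_principalIdeles_sup_normIdeles F θ
          (RingOfIntegers.ne_zero_of_not_isSquare F hθ)) }
  map_principal' x hx :=
    signCharOfIndexTwo_apply_of_mem (index_principalIdeles_sup_normIdeles F (θ : F) hθ)
      (Subgroup.mem_sup_left hx)

variable {F}

/-- Unfolding `quadraticHeckeChar`: it is the sign character of `P_F · N_{E/F} J_E`. [folklore] -/
theorem quadraticHeckeChar_apply {θ : 𝓞 F} (hθ : ¬ IsSquare (θ : F)) (x : ideleGroup F) :
    quadraticHeckeChar F θ hθ x = signCharOfIndexTwo (R := ℂ) (principalIdeles F ⊔ normIdeles F (θ : F))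
      (index_principalIdeles_sup_normIdeles F (θ : F) hθ) x := rfl

/-- `ω(x) = 1` on `P_F · N_{E/F} J_E`. [folklore] -/
theorem quadraticHeckeChar_apply_of_mem {θ : 𝓞 F} (hθ : ¬ IsSquare (θ : F)) {x : ideleGroup F}
    (hx : x ∈ principalIdeles F ⊔ normIdeles F (θ : F)) : quadraticHeckeChar F θ hθ x = 1 := by
  rw [quadraticHeckeChar_apply, signCharOfIndexTwo_apply_of_mem _ hx]

/-- `ω(x) = -1` off `P_F · N_{E/F} J_E`. [folklore] -/
theorem quadraticHeckeChar_apply_of_not_mem {θ : 𝓞 F} (hθ : ¬ IsSquare (θ : F)) {x : ideleGroup F}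
    (hx : x ∉ principalIdeles F ⊔ normIdeles F (θ : F)) : quadraticHeckeChar F θ hθ x = -1 := by
  rw [quadraticHeckeChar_apply, signCharOfIndexTwo_apply_of_not_mem _ hx]

/-- `ω(x)² = 1`. [folklore] -/
theorem quadraticHeckeChar_apply_sq {θ : 𝓞 F} (hθ : ¬ IsSquare (θ : F)) (x : ideleGroup F) :
    quadraticHeckeChar F θ hθ x ^ 2 = 1 := by
  by_cases hx : x ∈ principalIdeles F ⊔ normIdeles F (θ : F)
  · rw [quadraticHeckeChar_apply_of_mem hθ hx, one_pow]
  · rw [quadraticHeckeChar_apply_of_not_mem hθ hx, neg_one_sq]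

/-- **`ω` has order `2`**, in particular finite order. [folklore] -/
theorem isFiniteOrder_quadraticHeckeChar {θ : 𝓞 F} (hθ : ¬ IsSquare (θ : F)) :
    (quadraticHeckeChar F θ hθ).IsFiniteOrder :=
  isOfFinOrder_iff_pow_eq_one.mpr ⟨2, two_pos, HeckeCharacter.ext fun x ↦ by
    rw [HeckeCharacter.pow_apply, HeckeCharacter.one_apply, quadraticHeckeChar_apply_sq]⟩

/-- **Units are norms at the places `v ∤ 2θ`** (O'Meara Example 63:12): for `v ∤ 2` with `θ` a
`v`-unit, the idèle `⟨u⟩_v` of a local unit `u ∈ 𝒪_vˣ` is a norm idèle of `F(√θ)/F`.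
[cite: Omeara1963, §63 Example 63:12] -/
theorem localUnits_mem_normIdeles_of_valued_eq_one {θ : 𝓞 F} {v : HeightOneSpectrum (𝓞 F)}
    (h2 : (2 : 𝓞 F) ∉ v.asIdeal) (hv : θ ∉ v.asIdeal) {u : (v.adicCompletion F)ˣ}
    (hu : Valued.v (u : v.adicCompletion F) = 1) : localUnits v u ∈ normIdeles F (θ : F) := by
  haveI : CharZero (v.adicCompletion F) :=
    charZero_of_injective_algebraMap (algebraMap F _).injective
  have hθ0 : θ ≠ 0 := by rintro rfl; exact hv (zero_mem _)
  have hθv : algebraMap F (v.adicCompletion F) (θ : F) ≠ 0 :=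
    (map_ne_zero _).2 (by exact_mod_cast hθ0)
  rw [localUnits_mem_normIdeles_iff]
  refine (hilbertSymbol_eq_one_iff_mem_quadraticNormSubgroup hθv u).1 ?_
  have key := hilbertSymbol_eq_one_of_valued_eq_one_of_notMem F v h2 hv hu
  rw [IsScalarTower.algebraMap_apply (𝓞 F) F (v.adicCompletion F)] at key
  exact key

/-- **`ω` is unramified at every `v ∤ 2θ`.** [cite: ArthurClozelAMS120, Ch. 3, proof of Thm. 3.1
(p. 172)] -/
theorem isUnramifiedAt_quadraticHeckeChar {θ : 𝓞 F} (hθ : ¬ IsSquare (θ : F))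
    {v : HeightOneSpectrum (𝓞 F)} (h2 : (2 : 𝓞 F) ∉ v.asIdeal) (hv : θ ∉ v.asIdeal) :
    (quadraticHeckeChar F θ hθ).IsUnramifiedAt v := fun u ↦
  quadraticHeckeChar_apply_of_mem hθ (Subgroup.mem_sup_right
    (localUnits_mem_normIdeles_of_valued_eq_one h2 hv
      (HeightOneSpectrum.adicCompletionIntegers.isUnit_iff_valued_eq_one.1 u.isUnit)))

/-- **`ω(ϖ_v) = 1` at a split place**: if `θ ∈ F_v²` every `v`-idèle is a norm idèle (O'Meara
Example 65:2, `range_localUnits_le_normIdeles_of_isSquare`). [cite: Omeara1963, §71C Prop. 71:17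
(proof, step 1)] -/
theorem valueAtUniformizer_quadraticHeckeChar_of_isSquare {θ : 𝓞 F} (hθ : ¬ IsSquare (θ : F))
    {v : HeightOneSpectrum (𝓞 F)} (hsq : IsSquare (algebraMap F (v.adicCompletion F) (θ : F))) :
    (quadraticHeckeChar F θ hθ).valueAtUniformizer v = 1 := by
  have hθ0 : (θ : F) ≠ 0 := by exact_mod_cast RingOfIntegers.ne_zero_of_not_isSquare F hθ
  rw [HeckeCharacter.valueAtUniformizer, HeckeCharacter.localComponent_apply,
    quadraticHeckeChar_apply_of_mem hθ (Subgroup.mem_sup_right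
      (range_localUnits_le_normIdeles_of_isSquare hθ0 v hsq ⟨_, rfl⟩)), Units.val_one]

/-- Every `u ∈ F_vˣ` is `u₀ ϖ_v^{-m}` with `u₀` a local unit (`m = log v(u)`), so a subgroup
containing the `⟨u₀⟩_v` for all local units `u₀` and `⟨ϖ_v⟩_v` contains all of `I_F^v`.
[folklore] -/
theorem range_localUnits_le_of_mem {G : Subgroup (ideleGroup F)} {v : HeightOneSpectrum (𝓞 F)}
    (hunits : ∀ u : (v.adicCompletion F)ˣ, Valued.v (u : v.adicCompletion F) = 1 → localUnits v u ∈ G)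
    (hϖ : localUnits v (HeckeCharacter.uniformizer F v) ∈ G) : (localUnits v).range ≤ G := by
  rintro _ ⟨u, rfl⟩
  set ϖ := HeckeCharacter.uniformizer F v with hϖdef
  set m : ℤ := WithZero.log (Valued.v (u : v.adicCompletion F)) with hm
  have hu0 : Valued.v (u : v.adicCompletion F) ≠ 0 := (Valuation.ne_zero_iff _).2 u.ne_zero
  set u₀ : (v.adicCompletion F)ˣ := u * ϖ ^ m with hu₀
  have hu₀v : Valued.v (u₀ : v.adicCompletion F) = 1 := by
    rw [hu₀, Units.val_mul, Units.val_zpow_eq_zpow_val, map_mul, map_zpow₀,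
      HeckeCharacter.valued_uniformizer, ← WithZero.exp_log hu0, ← hm, ← WithZero.exp_zsmul,
      ← WithZero.exp_add, smul_eq_mul, mul_neg, mul_one, add_neg_cancel, WithZero.exp_zero]
  have hu : u = u₀ * ϖ ^ (-m) := by
    rw [hu₀, mul_assoc, ← zpow_add, add_neg_cancel, zpow_zero, mul_one]
  rw [hu, map_mul, map_zpow]
  exact G.mul_mem (hunits u₀ hu₀v) (G.zpow_mem hϖ _)

/-- **`ω(ϖ_v) = -1` at an inert place, granted 71:17 there**: for `v ∤ 2θ`, if
`I_F^v ⊄ P_F · N_{E/F} J_E` then `⟨ϖ_v⟩_v ∉ P_F · N_{E/F} J_E` (the local units being inside), so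
`ω(ϖ_v) = -1` ("`ζ_v = η(ϖ_v)` has order `f_v = 2`", Arthur–Clozel p. 172).
[cite: ArthurClozelAMS120, Ch. 3, proof of Thm. 3.1 (p. 172)] -/
theorem valueAtUniformizer_quadraticHeckeChar_of_not_le {θ : 𝓞 F} (hθ : ¬ IsSquare (θ : F))
    {v : HeightOneSpectrum (𝓞 F)} (h2 : (2 : 𝓞 F) ∉ v.asIdeal) (hv : θ ∉ v.asIdeal)
    (hnot : ¬ ((localUnits v).range ≤ principalIdeles F ⊔ normIdeles F (θ : F))) :
    (quadraticHeckeChar F θ hθ).valueAtUniformizer v = -1 := by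
  have hϖ : localUnits v (HeckeCharacter.uniformizer F v) ∉
      principalIdeles F ⊔ normIdeles F (θ : F) := fun hmem ↦
    hnot (range_localUnits_le_of_mem (fun u hu ↦ Subgroup.mem_sup_right
      (localUnits_mem_normIdeles_of_valued_eq_one h2 hv hu)) hmem)
  rw [HeckeCharacter.valueAtUniformizer, HeckeCharacter.localComponent_apply,
    quadraticHeckeChar_apply_of_not_mem hθ hϖ, Units.val_neg, Units.val_one]

end Character

/-! ### The Hecke character of a quadratic extension and `exists_twist_quadraticSign` -/

section Main

variable {F E : Type} [Field F] [NumberField F] [Field E] [NumberField E] [Algebra F E]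

/-- **The quadratic Hecke character `ω_{E/F}` and its values at uniformizers, from O'Meara 71:17.**
Let `E/F` be a quadratic extension of number fields and assume Prop. 71:17 for `F`
(`range_localUnits_not_le_of_inertiaDegIn_eq_two F`: `I_F^𝔮 ⊄ P_F N_{E/F} J_E` at the places `𝔮`
inert in `E`). Then there is a Hecke character `ω` of `F` of finite order such that, at almost
every finite place `v` (namely `v ∤ 2θ` unramified in `E`, for `E = F(√θ)`, `θ ∈ 𝓞 F`), `ω` is
unramified and `ω(ϖ_v) = ε_{E/F}(v)` (`quadraticSign`: `+1` if `v` splits in `E`, `-1` if `v` is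
inert): `ω = quadraticHeckeChar F θ`, the character of `𝕀_F / F^× N_{E/F} J_E ≅ ℤ/2` (norm index
theorem 65:21), with `ω(ϖ_v) = 1` iff `θ ∈ F_v²` iff `v` splits (O'Meara §65A). This is the
statement `exists_heckeCharacter_quadraticSign` of `LanglandsTunnellTwist` with Artin reciprocity
replaced by the class field theory of quadratic extensions.
[cite: ArthurClozelAMS120, Ch. 3, proof of Thm. 3.1 (p. 172)] [cite: Omeara1963, §65D Prop. 65:21
and §71C Prop. 71:17] -/
theorem exists_heckeCharacter_quadraticSign_of_inert
    (h17 : range_localUnits_not_le_of_inertiaDegIn_eq_two F) (h2 : Module.finrank F E = 2) :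
    ∃ ω : HeckeCharacter F, ω.IsFiniteOrder ∧
      ∀ᶠ v : HeightOneSpectrum (𝓞 F) in Filter.cofinite,
        ω.IsUnramifiedAt v ∧ ω.valueAtUniformizer v = quadraticSign E v := by
  classical
  haveI : FiniteDimensional F E := Module.finite_of_finrank_eq_succ h2
  haveI : Algebra.IsQuadraticExtension F E := ⟨h2⟩
  haveI : IsGalois F E := inferInstance
  have hprime : (Module.finrank F E).Prime := by rw [h2]; exact Nat.prime_two
  -- `E = F(√θ)`, `θ ∈ 𝓞 F` a non-square
  obtain ⟨θ, α, hθ0, hα, hαF⟩ := exists_integer_sq_eq_of_finrank_eq_two h2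
  have hθ : ¬ IsSquare (θ : F) := by
    rintro ⟨r, hr⟩
    have hsq : α ^ 2 = (algebraMap F E r) ^ 2 := by rw [hα, hr, map_mul, sq]
    rcases eq_or_eq_neg_of_sq_eq_sq _ _ hsq with h | h
    · exact hαF r h.symm
    · exact hαF (-r) (by rw [map_neg, h])
  refine ⟨quadraticHeckeChar F θ hθ, isFiniteOrder_quadraticHeckeChar hθ, ?_⟩
  -- almost every `v`: `v ∤ 2θ` and `v` unramified in `E`
  have hS : ∀ᶠ v : HeightOneSpectrum (𝓞 F) in cofinite,
      θ ∉ v.asIdeal ∧ (2 : 𝓞 F) ∉ v.asIdeal := by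
    have h := ((finite_setOf_mem_asIdeal F hθ0).union
      (finite_setOf_mem_asIdeal F (two_ne_zero (α := 𝓞 F)))).compl_mem_cofinite
    filter_upwards [h] with v hv
    simpa only [Set.mem_compl_iff, Set.mem_union, Set.mem_setOf_eq, not_or] using hv
  have hunrE : ∀ᶠ v : HeightOneSpectrum (𝓞 F) in cofinite,
      Algebra.IsUnramifiedIn (𝓞 E) v.asIdeal := by
    rw [Filter.eventually_cofinite]
    exact finite_setOf_not_isUnramifiedIn F E
  filter_upwards [hS, hunrE] with v hv hvE
  refine ⟨isUnramifiedAt_quadraticHeckeChar hθ hv.2 hv.1, ?_⟩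
  have hcard : Nat.card {w : HeightOneSpectrum (𝓞 E) // w.under (𝓞 F) = v} =
      (finitePlacesOver E v).ncard :=
    Nat.card_coe_set_eq (finitePlacesOver E v)
  unfold quadraticSign
  by_cases hsq : IsSquare (algebraMap F (v.adicCompletion F) (θ : F))
  · -- `v` splits: `ω(ϖ_v) = 1 = ε`
    rw [valueAtUniformizer_quadraticHeckeChar_of_isSquare hθ hsq]
    have h2pl : (finitePlacesOver E v).ncard = 2 :=
      (QuadraticExtension.ncard_finitePlacesOver_eq_two_iff_isSquare hα hαF v).2 hsq
    rcases placesOver_dichotomy_of_prime hprime hvE with ⟨-, hsplit⟩ | ⟨h1, -⟩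
    · obtain ⟨w₀, hw₀⟩ := exists_above (E := E) v
      rw [if_pos ⟨w₀, hw₀, hsplit w₀ (HeightOneSpectrum.ext hw₀)⟩]
    · rw [hcard, h2pl] at h1
      exact absurd h1 (by norm_num)
  · -- `v` is inert: `ω(ϖ_v) = -1 = ε` by 71:17
    have h1pl : (finitePlacesOver E v).ncard = 1 :=
      (QuadraticExtension.ncard_finitePlacesOver_eq_one_iff_not_isSquare hα hαF v).2 hsq
    have hf : v.asIdeal.inertiaDegIn (𝓞 E) = 2 := by
      have h := QuadraticExtension.ncard_finitePlacesOver_mul_eq_two (E := E) v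
      rwa [h1pl, one_mul, ramificationIdxIn_eq_one_of_isUnramifiedIn hvE, one_mul] at h
    rw [valueAtUniformizer_quadraticHeckeChar_of_not_le hθ hv.2 hv.1
      (h17 E (θ : F) α hα hαF v hf)]
    rcases placesOver_dichotomy_of_prime hprime hvE with ⟨h2', -⟩ | ⟨-, hinert⟩
    · rw [hcard, h1pl, h2] at h2'
      exact absurd h2' (by norm_num)
    · rw [if_neg]
      rintro ⟨w, hw, hfw⟩
      rw [hinert w (HeightOneSpectrum.ext hw), h2] at hfw
      exact absurd hfw (by norm_num)

/-- **`exists_twist_quadraticSign` from O'Meara 71:17.** Granting Prop. 71:17 over every number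
field (`range_localUnits_not_le_of_inertiaDegIn_eq_two`, the decomposition law at inert primes,
the last input of Hilbert reciprocity in the tree): for a quadratic extension `E/F` and a cuspidal
`π` on `GL_n(𝔸_F)`, the cuspidal `π' = π ⊗ (ω_{E/F} ∘ det)` (Borel–Jacquet model,
`CuspidalAutomorphicRepData.twist`) has Satake parameter `ε_{E/F}(v) · t_{π,v}` at almost every
`v` (`AutomorphicRepData.eventually_hasSatakeParamAt_twist` and
`exists_heckeCharacter_quadraticSign_of_inert`) — Arthur–Clozel's "`ζ_v = η(ϖ_v)` … a root of
unity of order `f_v`" for the twist `π ⊗ η`. [cite: ArthurClozelAMS120, Ch. 3, proof of Thm. 3.1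
(p. 172) and Thm. 4.2 (d)] [cite: Omeara1963, §71C Prop. 71:17] -/
theorem exists_twist_quadraticSign_of_range_localUnits_not_le
    (h17 : ∀ (K : Type) [Field K] [NumberField K], range_localUnits_not_le_of_inertiaDegIn_eq_two K) :
    exists_twist_quadraticSign := by
  intro n F E _ _ _ _ _ h2 hF π
  obtain ⟨ω, hωfin, hω⟩ := exists_heckeCharacter_quadraticSign_of_inert (E := E) (h17 F) h2
  refine ⟨π.twist ω hωfin, ?_⟩
  filter_upwards [π.1.eventually_hasSatakeParamAt_twist hωfin, hω] with v hv hωv α hα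
  rw [← hωv.2]
  exact hv α hα

/-- **Hilbert reciprocity (71:18) implies O'Meara 71:17.** Let `E = K(α)`, `α² = θ`, `α ∉ K`, and
`𝔮` with `f_𝔮 = 2`; then `θ ∉ K_𝔮²` (one place above `𝔮`, O'Meara §65A), so some `t ∈ K_𝔮ˣ` is a
local non-norm (`(t, θ)_𝔮 = -1`, O'Meara 63:13). If `I_K^𝔮 ⊆ P_K N_{E/K} J_E`, write the idèle
`⟨t⟩_𝔮 = (γ) n`: the places where `(γ, θ)_𝔭 = -1` are those where `⟨t⟩_𝔮` is a local non-norm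
(`exists_placeSymbol_eq_neg_one_iff_of_mem_sup`), i.e. exactly `𝔮` — one place, against the
evenness asserted by `hilbertReciprocity K γ θ`. (The converse, 71:17 ⇒ 71:18 with the theorems of
the tree, is `hilbertReciprocity_of_facts`.) [cite: Omeara1963, §71C Prop. 71:17 and §71D
Thm. 71:18] -/
theorem range_localUnits_not_le_of_hilbertReciprocity (K : Type) [Field K] [NumberField K]
    (hHR : ∀ a b : K, hilbertReciprocity K a b) :
    range_localUnits_not_le_of_inertiaDegIn_eq_two K := by
  intro E _ _ _ _ θ α hα hαK v hf hle
  classical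
  haveI : CharZero (v.adicCompletion K) :=
    charZero_of_injective_algebraMap (algebraMap K _).injective
  have hθ0 : θ ≠ 0 := QuadraticExtension.ne_zero_of_sq_eq hα hαK
  -- one place above `v`, so `θ ∉ K_v²`
  have h1 : (finitePlacesOver E v).ncard = 1 := by
    rcases QuadraticExtension.ncard_finitePlacesOver_eq_one_or_two (E := E) v with h1 | h2
    · exact h1
    · have h := QuadraticExtension.ncard_finitePlacesOver_mul_eq_two (E := E) v
      rw [h2, hf] at h
      omega
  have hnsq : ¬ IsSquare (algebraMap K (v.adicCompletion K) θ) :=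
    (QuadraticExtension.ncard_finitePlacesOver_eq_one_iff_not_isSquare hα hαK v).1 h1
  -- a local non-norm `t` at `v`
  have hθv : algebraMap K (v.adicCompletion K) θ ≠ 0 := (map_ne_zero _).2 hθ0
  obtain ⟨t, ht0, ht⟩ := adicCompletion_exists_hilbertSymbol_eq_neg_one_holds K v _ hθv hnsq
  have htN : Units.mk0 t ht0 ∉ quadraticNormSubgroup (v.adicCompletion K) (algebraMap K _ θ) :=
    (hilbertSymbol_eq_neg_one_iff_not_mem_quadraticNormSubgroup hθv (Units.mk0 t ht0)).1 ht
  -- `⟨t⟩_v ∈ P ⊔ N`, read off `γ`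
  have hmem : localUnits v (Units.mk0 t ht0) ∈ principalIdeles K ⊔ normIdeles K θ := hle ⟨_, rfl⟩
  obtain ⟨γ, hγ⟩ := exists_placeSymbol_eq_neg_one_iff_of_mem_sup hθ0 hmem
  have hbad : badPlaces (γ : K) θ = {Sum.inl v} := by
    ext p
    rw [mem_badPlaces_iff, hγ, Set.mem_singleton_iff]
    cases p with
    | inl v' =>
      rw [isLocalNormAt_inl]
      by_cases hv' : v' = v
      · subst hv'
        rw [ideleFiniteComponent_localUnits_self]
        exact ⟨fun _ ↦ rfl, fun _ ↦ htN⟩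
      · rw [ideleFiniteComponent_localUnits_of_ne K _ hv']
        simp only [one_mem, not_true_eq_false, Sum.inl.injEq, hv']
    | inr w =>
      rw [isLocalNormAt_inr, ideleInfiniteComponent_localUnits]
      simp only [one_mem, not_true_eq_false, reduceCtorEq]
  -- one exceptional place: odd, against Hilbert reciprocity
  have hcard := ncard_badPlaces (K := K) γ.ne_zero hθ0
  rw [hbad, Set.ncard_singleton] at hcard
  have heven := (hHR (γ : K) θ γ.ne_zero hθ0).2
  rw [← hcard] at heven
  exact Nat.not_even_one heven

/-- **`exists_twist_quadraticSign` from Hilbert's reciprocity law.** If `∏_𝔭 (a, b)_𝔭 = 1` for all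
`a, b` in every number field (`hilbertReciprocity`, O'Meara Thm. 71:18), then the quadratic twist
`π ⊗ ω_{E/F}` exists with Satake parameters `ε_{E/F}(v) t_{π,v}` a.e.
(`exists_twist_quadraticSign_of_range_localUnits_not_le` and
`range_localUnits_not_le_of_hilbertReciprocity`). [cite: ArthurClozelAMS120, Ch. 3, proof of
Thm. 3.1 (p. 172) and Thm. 4.2 (d)] [cite: Omeara1963, §71D Thm. 71:18] -/
theorem exists_twist_quadraticSign_of_hilbertReciprocity
    (hHR : ∀ (K : Type) [Field K] [NumberField K] (a b : K), hilbertReciprocity K a b) :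
    exists_twist_quadraticSign :=
  exists_twist_quadraticSign_of_range_localUnits_not_le fun K _ _ ↦
    range_localUnits_not_le_of_hilbertReciprocity K (hHR K)

end Main

end Literature.NumberTheory.Automorphic
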